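import Literature.MathematicalPhysics.QuantumFieldTheory.BalabanImbrieJaffe1984to88.BIJ88Eq5128Split
import Literature.MathematicalPhysics.QuantumFieldTheory.BalabanImbrieJaffe1984to88.BIJ88Eq5128CondExpect

/-!
# `BalabanImbrieJaffe1984to88.BIJ88Eq5128Display` — T. Bałaban, J. Imbrie, A. Jaffe, *Effective action and cluster properties of the
abelian Higgs model*, Commun. Math. Phys. **114** (1988) 257–315 [BalabanImbrieJaffe1988], **(5.12.8)** p. 303 [PDF 47] — **THE DISPLAY
"AFTER THE CONDITIONING" AS A PREDICATE AT MEASURE LEVEL, WITH ITS READING TABLE.**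

statement-level skeleton of published theorems with citation tags; proofs where landed; nothing here is a claim about the Yang–Mills mass gap

THE PRINTED DISPLAY (p. 303 [PDF 47], verbatim; re-read this session as an image, `renders/c2-p047.png` of the seat folder).  *"After the
conditioning our density assumes the following form:
ρ^L_{k+1}(v, ψ) = Σ_{{X_ω}} Σ_{Λ^{(k)}_0} Σ_{S_4} Σ_{σ̃_1} Σ_{Λ̃^{(k)}_9} ∫ Π_{j=0}^{k} du^{(j)}|_{Λ^{(j)c*}_{10}} dφ^{(k)}|_{Λ^{(k)c}_{10}} δ_{Ax,Λ^{(k)c′}_{10}}(u^{(k)})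
 × δ_{Λ^{(k)′*c}_1}(v/Qu^{(k)}) δ_{Λ^{(k)′*}_1∩Λ^{(k)′c*}_{10}}((e_k/2π) QA^{(k)}) ζ_{Λ^{(k)c}_0} χ_{Λ^{(k)}_0∩Λ^{(k)c}_9} ζ′_{Λ̃^{(k)c}} χ_{k+1,Λ^{(k)′}_0} Π_ω g_k(X_ω)
 × Π_{σ∉σ̃_1} F′_{(k),loc}(X_σ) Π_{(j,x_j,X)∈S_4} (e^{−W^{(k)}_{4,j}(x_j,X)} − 1) Π_{j=0}^{k} [Z^{(j)}_{Λ^{(j)c*c}_{10}} Z^{(j)}_{Λ^{(j)}_{10}}(u_{k+1})]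
 × exp[ −½⟨Λ^{(k)′**}_5 f, σ^L_{k+1,loc}Λ^{(k)′**}_5 f⟩ − ½⟨Λ^{(k)′}_8ψ, Δ^L_{k+1,loc}(u_{k+1})Λ^{(k)′}_8ψ⟩ − Σ_{i=1}^{8} 𝒬_i
   − ℰ_k − E^{(k)} − 𝒫_{k,loc}(Λ^{k+1}_8, Λ^{(k)c}_8, ũ_{k+1}) − R^{(k)}(Λ^{(k)c}_8, u_{k+1}, θ_kH_{k,loc}A^{(k)}) − Q^{(k)}(Λ^{(k)c}_8, u_{k+1}, θ_kH_{k,loc}A^{(k)}) ]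
 ∫dμ^{(k)}_{Λ^{(k)}_{10}}(A^{(k)″}, φ^{(k)″}) χ′_{Λ^{(k)}_7} Π_{σ_1∈σ̃_1} F^{m̄}_{k,loc}(X_{σ_1}) × exp[ −V^{(k)}(Λ^{(k)}_8, u_{k+1}, A^{(k)}, φ^{(k)}) − Σ_X W^{(k)}_5(X) ].   (5.12.8)
The next two sections will focus on deriving a cluster expansion for the dμ^{(k)}_{Λ^{(k)}_{10}} integral in (5.12.8)"*.

THE MEASURE-LEVEL FORM (this file; same reading as this seat's `BIJ88Eq596Display.IsDT` for (5.9.6), of which (5.12.8) is the image under the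
operations of Sects. 5.10–5.12).  `ρ^L_{k+1}` is a `(v, ψ)`-density w.r.t. `dv dψ`; the display says that for every bounded measurable test `g`,
  `∫dv dψ ρ^L_{k+1} g = Σ_{t ∈ terms} ∫dv′ ∫dψ ∫_{EXTERIOR} X_t · ( ∫_{INTERIOR} B_t dμ_t ) · g(v_Λ, ψ)`      (`IsDC`)
where: `terms` = the quintuple sum `({X_ω}, Λ^{(k)}_0, S_4, σ̃_1, Λ̃^{(k)}_9)`; the EXTERIOR integral is against `ext_t` = *"Π_{j=0}^{k} du^{(j)}|_{Λ^{(j)c*}_{10}}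
dφ^{(k)}|_{Λ^{(k)c}_{10}}"* (this seat's `BIJ88Eq5128Split.Interior.extMeasure`: the product one-bond/one-site laws on the EXTERIOR index sets, the
interior variables frozen), the `δ`-functions of lines 1–2 being — as in gens 5–9 — the push-forward reading `u^{(k)} = u′_Λ(u)` (`uCut`), `v = v_Λ(u, v′)`
(`vCut`: free on `Λ_t = Λ^{(k)′*}_1`, `Qu^{(k)}` elsewhere), `δ_{Ax}` = the Dirac factors of `𝒟u δ_{Ax}` (`axialMeasure_eq_pi`); `X_t` = the EXTERIOR
BRACKET (lines 2–7 up to `]`; reading table `Exterior5128`, one slot per printed factor); `μ_t` = `dμ^{(k)}_{Λ^{(k)}_{10}}(A^{(k)″}, φ^{(k)″})`, the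
normalized interior law given the exterior variables (`cond`; for the printed Gaussian weight it is (5.12.7) — p02's `BIJ88Measure5127.mu` in real
coordinates; here `condW` = `𝒩⁻¹·W·(interior product law)` read on the configuration space); `B_t` = the INTERIOR BRACKET `χ′_{Λ^{(k)}_7} Π F^{m̄}
exp[−V^{(k)} − Σ W^{(k)}_5]` (reading table `Interior5128`).

WHAT IS TYPED / PROVED (defs with bodies + theorems; 0 `sorry`; no `Prop`-valued fact; standard axioms).  §1 `IsDC` (the display), congruence,
normalization, uniqueness a.e.; `normW`/`condW` (the factor `𝒩` and the measure `dμ^{(k)}_{Λ^{(k)}_{10}}` on the configuration space, from a weight),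
`normW_freeze`/`condW_freeze`, `integral_condW_glue`, `isProbabilityMeasure_condW`; §0 the one-bond laws `axialLaw` of `∫𝒟u δ_{Ax}`
(`axialMeasure = Π_b axialLaw_b`).  §2 the READING TABLE: `Exterior5128`, `Interior5128` (one typed slot per printed factor, docstring =
the printed symbol and the equation constructing it — rows C2.Eq5.2.x–5.12.7 of the skeleton, NOT repeated), `exteriorExponent5128`,
`exteriorBracket5128`, `interiorBracket5128`, and the reading `readEntry` of a table entry on a configuration through `uCut`/`vCut`; `IsDC5128` = `IsDC` with the
transcribed brackets.  §3 the RE-INDEXING of the translated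
display under the expansions of Sect. 5.11 / p. 300 (Mayer expansion I (5.11.2), the observable and characteristic-function expansions *"summed over
subsets"*): `isDT_expand` — a pointwise finite-sum identity of brackets enlarges the family of terms (`(5.9.6)` over `({X_ω},Λ_0)` ⇒ the same display
over `({X_ω},Λ_0,S_4,σ̃_1,Λ̃_9)`), PROVED under joint integrability of the pieces.  The passage (5.9.6) ⇒ (5.12.8) itself (the conditioning) is the
companion file `BIJ88Eq5128Frame`.
Seat p34 gen 10, file 3 (own lineage = the C1/C2 renormalization-transformation line at measure level).

CITATION HEADER (lean-in-tree rule).  Part of the lit-balaban TYPED SKELETON (HOME `run/shared/lean/pub/lit-balaban/`), PHASE-2 proof seat p34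
gen 10 (unit `lit-balaban-p34-g10`; TAKING line HOME/STATUS.md 2026-08-22T00:14:36Z).  Row served: **`C2.Eq5.12.8`** of
`HOME/lit-balaban-r16/ROWS-C2-part2.md` (owner r16; ABSENT before this file); support `C2.Eq5.11.2` ((5.11.2) is r16's `eq5112`, entering
`isDT_expand` as the pointwise hypothesis), `C2.Txt@300`, `C2.Eq5.12.1-5.12.7`.
PDF held: `paper:balaban1988-cmp114-bij-abelian-higgs-effective-action` (journal page = PDF page + 256); pp. 297–303 rendered and read this session.
Imports this seat's `BIJ88Eq5128Split`, `BIJ88Eq5128CondExpect` (Literature + Mathlib only).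
-/

namespace Literature.MathematicalPhysics.QuantumFieldTheory.BalabanImbrieJaffe1984to88.BIJ88Eq5128Display

open Literature.MathematicalPhysics.QuantumFieldTheory.Balaban1983to89
open BIJ88Sect3Statements (U1)
open BIJ85Sect1Model (HiggsField)
open BIJ88InductiveForm41 (Prev prevMeasure)
open BIJ88RT51Unique (ae_eq_of_forall_test integral_test_congr_ae)
open BIJ88Eq596Display (uCut vCut IsDT)
open BIJ88Eq5128CondExpect (condNorm condMeasure isProbabilityMeasure_condMeasure integral_condMeasure_mul condNorm_pos)
open BIJ88Eq5128Split (Cfg UCfg PCfg cfgMeasure prevPi prevMeasure_eq_prevPi Interior)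
open scoped BigOperators ENNReal
open _root_.MeasureTheory _root_.MeasureTheory.Measure Function Set

noncomputable section

variable {P : Params} {k : ℕ}

/-! ## §0 The one-bond laws of `∫𝒟u δ_{Ax}(u)(·)` -/

/-- The one-bond laws of `∫𝒟u δ_{Ax}(u)(·)`: Dirac mass at `1` on the tree bonds, Haar measure elsewhere (`axialMeasure_eq_pi`).
[cite: BalabanImbrieJaffe1988, (3.11) p.266] -/
def axialLaw (P : Params) (k : ℕ) (b : PBond P k) : Measure U1 :=
  if b ∈ (BIJ88RenormTransf311.axialBonds : Finset (PBond P k)) then Measure.dirac (1 : U1) else (HaarData.haar : Measure U1)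

/-- kernel: each one-bond law of `∫𝒟u δ_{Ax}(u)(·)` is a probability measure. [cite: BalabanImbrieJaffe1988, (3.11) p.266] -/
instance isProbabilityMeasure_axialLaw (b : PBond P k) : IsProbabilityMeasure (axialLaw P k b) := by
  unfold axialLaw
  by_cases hb : b ∈ (BIJ88RenormTransf311.axialBonds : Finset (PBond P k))
  · rw [if_pos hb]; infer_instance
  · rw [if_neg hb]; exact HaarData.isProb

/-- **`∫𝒟u δ_{Ax}(u)(·) = Π_b axialLaw_b`** (this seat's `BIJ88Eq5128Split.axialMeasure_eq_pi`). [cite: BalabanImbrieJaffe1988, (3.11) p.266] -/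
theorem axialMeasure_eq_pi_axialLaw :
    (BIJ88RenormTransf311.axialMeasure P k U1 : Measure (UCfg P k)) = Measure.pi (axialLaw P k) :=
  BIJ88Eq5128Split.axialMeasure_eq_pi

/-- **`𝒟u = Π_b du_b`** (Haar one-bond laws; definitional). [cite: BalabanImbrieJaffe1988, (5.12.8) p.303] -/
theorem fieldMeasure_eq_pi_haar :
    (fieldMeasure P k U1 : Measure (UCfg P k)) = Measure.pi fun _ : PBond P k => (HaarData.haar : Measure U1) := rfl

/-! ## §1 The display (5.12.8) at measure level -/

section Display

/-- **(5.12.8) p. 303 [PDF 47] AT MEASURE LEVEL** (verbatim in the module docstring) — *"After the conditioning our density assumes the following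
form"*: `ρ̃ = ρ^L_{k+1}` is a `(v, ψ)`-density w.r.t. `dv dψ` such that for every bounded measurable test function `g`,
`∫dv dψ ρ̃ g = Σ_{t∈terms} ∫dv′ ∫dψ ∫ext_t(dq) X_t(q, v′, ψ) · (∫ B_t(q′, v′, ψ) dμ_t[q, v′, ψ](q′)) · g(v_{Λ_t}(q, v′), ψ)`.
DATA: `terms` (the sums `Σ_{{X_ω}}Σ_{Λ₀}Σ_{S₄}Σ_{σ̃₁}Σ_{Λ̃₉}`), the cut-offs `Λ_t = Λ^{(k)′*}_1`, the block average `Qu`, the EXTERIOR MEASURES `ext_t`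
(line 1: `Π_{j≤k}du^{(j)}|_{Λ^{(j)c*}_{10}} dφ^{(k)}|_{Λ^{(k)c}_{10}}` with its `δ`'s, on the configuration space `Cfg P k` of `(u, {u^{(j)}}, φ^{(k)})`, the
bracket reading `u^{(k)} = u′_Λ(u)`), the EXTERIOR BRACKETS `X_t` (lines 2–7), the INTERIOR LAWS `μ_t[q, v′, ψ]` (`dμ^{(k)}_{Λ^{(k)}_{10}}`, depending on
the exterior variables) and the INTERIOR BRACKETS `B_t` (lines 7–8), all as functions of the configuration `q`, the free block field `v′` and `ψ`.
[cite: BalabanImbrieJaffe1988, (5.12.8) p.303] -/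
def IsDC {ι : Type*} (terms : Finset ι) (Λ : ι → Finset (PBond P (k+1))) (Qu : GaugeField P k U1 → GaugeField P (k+1) U1)
    (ext : ι → Measure (Cfg P k)) (X : ι → Cfg P k → GaugeField P (k+1) U1 → HiggsField P (k+1) → ℂ)
    (cond : ι → Cfg P k → GaugeField P (k+1) U1 → HiggsField P (k+1) → Measure (Cfg P k))
    (B : ι → Cfg P k → GaugeField P (k+1) U1 → HiggsField P (k+1) → ℂ)
    (ρL : GaugeField P (k+1) U1 → HiggsField P (k+1) → ℂ) : Prop :=
  ∀ g : GaugeField P (k+1) U1 × HiggsField P (k+1) → ℂ, Measurable g → (∃ C : ℝ, ∀ z, ‖g z‖ ≤ C) →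
    ∫ v, ∫ ψ, ρL v ψ * g (v, ψ) ∂volume ∂fieldMeasure P (k+1) U1 =
      ∑ t ∈ terms, ∫ v', ∫ ψ, ∫ q,
        X t q v' ψ * (∫ q', B t q' v' ψ ∂cond t q v' ψ) * g (vCut Qu (Λ t) q.1 v', ψ)
        ∂ext t ∂volume ∂fieldMeasure P (k+1) U1

variable {ι : Type*} {terms : Finset ι} {Λ : ι → Finset (PBond P (k+1))} {Qu : GaugeField P k U1 → GaugeField P (k+1) U1}
variable {ext : ι → Measure (Cfg P k)} {X X' B B' : ι → Cfg P k → GaugeField P (k+1) U1 → HiggsField P (k+1) → ℂ}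
variable {cond : ι → Cfg P k → GaugeField P (k+1) U1 → HiggsField P (k+1) → Measure (Cfg P k)}
variable {ρL ρL' : GaugeField P (k+1) U1 → HiggsField P (k+1) → ℂ}

/-- Rewriting the two brackets pointwise does not change the display (the algebraic rewritings of Sects. 5.13–5.15 of the interior integrand enter
this way). [cite: BalabanImbrieJaffe1988, (5.12.8) p.303] -/
theorem IsDC.congr (h : IsDC terms Λ Qu ext X cond B ρL) (hX : ∀ t ∈ terms, ∀ q v' ψ, X' t q v' ψ = X t q v' ψ)
    (hB : ∀ t ∈ terms, ∀ q v' ψ, B' t q v' ψ = B t q v' ψ) : IsDC terms Λ Qu ext X' cond B' ρL := fun g hg hb => by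
  rw [h g hg hb]
  refine Finset.sum_congr rfl fun t ht => ?_
  simp only [hX t ht, hB t ht]

/-- Normalization of (5.12.8) (test `g ≡ 1`): `∫dvdψ ρ̃ = Σ_t ∫dv′∫dψ∫ext_t X_t·(∫B_t dμ_t)`. [cite: BalabanImbrieJaffe1988, (5.12.8) p.303] -/
theorem integral_eq_of_isDC (h : IsDC terms Λ Qu ext X cond B ρL) :
    ∫ v, ∫ ψ, ρL v ψ ∂volume ∂fieldMeasure P (k+1) U1 =
      ∑ t ∈ terms, ∫ v', ∫ ψ, ∫ q, X t q v' ψ * (∫ q', B t q' v' ψ ∂cond t q v' ψ) ∂ext t ∂volume ∂fieldMeasure P (k+1) U1 := by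
  have h1 := h (fun _ => (1 : ℂ)) measurable_const ⟨1, fun _ => by simp⟩
  simp only [mul_one] at h1
  exact h1

/-- **(5.12.8) determines `ρ^L_{k+1}` `dv dψ`-almost everywhere**: two integrable densities satisfying the display for the same data agree a.e.
[cite: BalabanImbrieJaffe1988, (5.12.8) p.303] -/
theorem isDC_unique (h : IsDC terms Λ Qu ext X cond B ρL) (h' : IsDC terms Λ Qu ext X cond B ρL')
    (hi : Integrable (uncurry ρL) ((fieldMeasure P (k+1) U1).prod volume))
    (hi' : Integrable (uncurry ρL') ((fieldMeasure P (k+1) U1).prod volume)) :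
    uncurry ρL =ᵐ[(fieldMeasure P (k+1) U1).prod volume] uncurry ρL' :=
  ae_eq_of_forall_test hi hi' fun g hg hb => by rw [h g hg hb, h' g hg hb]

/-- A `dv dψ`-integrable function a.e. equal to an integrable solution of (5.12.8) is a solution. [cite: BalabanImbrieJaffe1988, (5.12.8) p.303] -/
theorem isDC_congr_ae (h : IsDC terms Λ Qu ext X cond B ρL)
    (hi : Integrable (uncurry ρL) ((fieldMeasure P (k+1) U1).prod volume))
    (hi' : Integrable (uncurry ρL') ((fieldMeasure P (k+1) U1).prod volume))
    (hae : uncurry ρL' =ᵐ[(fieldMeasure P (k+1) U1).prod volume] uncurry ρL) : IsDC terms Λ Qu ext X cond B ρL' := fun g hg hb => by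
  rw [integral_test_congr_ae hi hi' hae hg hb]
  exact h g hg hb

end Display

/-! ## §1b `𝒩` and `dμ^{(k)}_{Λ^{(k)}_{10}}` on the configuration space, from a weight -/

namespace Weight

variable (D : Interior P k) (m : PBond P k → Measure U1) (W : Cfg P k → ℝ)

/-- **`𝒩` OF ONE TERM AS A FUNCTION OF THE CONFIGURATION** (*"𝒩 is equal to the last integral, without G"*): the total `W`-weight of the interior
fibre through `q` — `𝒩(q) = ∫ W(glue((split q).1, i)) dμInt(i)`, a function of the exterior variables of `q` only. [cite: BalabanImbrieJaffe1988, (5.12.2) p.301] -/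
def normW (q : Cfg P k) : ℝ := condNorm (D.μInt m) fun i => W (D.glue (D.split q).1 i)

/-- **`dμ^{(k)}_{Λ^{(k)}_{10}}` OF ONE TERM ON THE CONFIGURATION SPACE**: the interior product law re-weighted by `W` and normalized, over the exterior
variables of `q`, read on `Cfg P k` (for the printed Gaussian `W` this is (5.12.7)). [cite: BalabanImbrieJaffe1988, (5.12.7) p.302] -/
def condW (q : Cfg P k) : Measure (Cfg P k) := D.fibreMeasure (condMeasure (D.μInt m) fun i => W (D.glue (D.split q).1 i)) (D.split q).1

variable {D m W}

/-- `𝒩` depends on the exterior variables only: `normW (freeze q) = normW q`. [cite: BalabanImbrieJaffe1988, (5.12.2) p.301] -/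
theorem normW_freeze (q : Cfg P k) : normW D m W (D.freeze q) = normW D m W q := by
  simp only [normW, Interior.split_freeze]

/-- `dμ^{(k)}_{Λ^{(k)}_{10}}` depends on the exterior variables only. [cite: BalabanImbrieJaffe1988, (5.12.7) p.302] -/
theorem condW_freeze (q : Cfg P k) : condW D m W (D.freeze q) = condW D m W q := by
  simp only [condW, Interior.split_freeze]

/-- `𝒩` at a glued configuration. [cite: BalabanImbrieJaffe1988, (5.12.2) p.301] -/
theorem normW_glue (e : D.Ext) (i : D.Int) : normW D m W (D.glue e i) = condNorm (D.μInt m) fun i' => W (D.glue e i') := by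
  simp only [normW, Interior.split_glue]

/-- **Integration against `dμ^{(k)}_{Λ^{(k)}_{10}}`** at a glued configuration: `∫ G dμ[glue e i] = ∫_{Int} G(glue e i′) d(𝒩⁻¹W μInt)(i′)`.
[cite: BalabanImbrieJaffe1988, (5.12.7) p.302] -/
theorem integral_condW_glue {E : Type*} [NormedAddCommGroup E] [NormedSpace ℝ E] (e : D.Ext) (i : D.Int) (G : Cfg P k → E) :
    ∫ q', G q' ∂condW D m W (D.glue e i) = ∫ i', G (D.glue e i') ∂condMeasure (D.μInt m) (fun i' => W (D.glue e i')) := by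
  simp only [condW, Interior.split_glue, Interior.integral_fibreMeasure]

/-- **`dμ^{(k)}_{Λ^{(k)}_{10}}` is normalized** (a probability measure) whenever the weight is measurable, positive and fibre-integrable (one-bond laws of
mass one). [cite: BalabanImbrieJaffe1988, (5.12.7) p.302] -/
theorem isProbabilityMeasure_condW [∀ b, IsProbabilityMeasure (m b)] (hW0 : ∀ q, 0 < W q)
    (hWi : ∀ e, Integrable (fun i => W (D.glue e i)) (D.μInt m)) (q : Cfg P k) : IsProbabilityMeasure (condW D m W q) := by
  unfold condW
  haveI : IsProbabilityMeasure (condMeasure (D.μInt m) fun i => W (D.glue (D.split q).1 i)) :=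
    isProbabilityMeasure_condMeasure (fun i => (hW0 _).le) (hWi _)
      (condNorm_pos (fun i => hW0 _) (hWi _))
  infer_instance

end Weight

/-! ## §2 The reading table of (5.12.8) -/

section Printed

variable {ι : Type*}

/-- The type of the entries of the brackets of (5.12.8): functions of the term and of `({u^{(j)}}_{j<k}, u^{(k)}, v, φ^{(k)}, ψ)` (`u^{(k)}` the translated
exterior-or-interior gauge field, `v` the block gauge field — through `f`, `u_{k+1}`, `ũ_{k+1}`). Same convention as `BIJ88Eq596Frame.Entry`.
[cite: BalabanImbrieJaffe1988, (5.12.8) p.303] -/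
abbrev Entry (P : Params) (k : ℕ) (ι : Type*) (α : Type) : Type _ :=
  ι → Prev P k → GaugeField P k U1 → GaugeField P (k+1) U1 → HiggsField P k → HiggsField P (k+1) → α

/-- Reading an entry on a configuration `q = (u, {u^{(j)}}, φ^{(k)})`, the free block field `v′` and `ψ`: `u^{(k)} = u′_{Λ_t}(u)` (`uCut`), `v = v_{Λ_t}(u, v′)`
(`vCut`) — the `δ`-functions of lines 1–2 in the push-forward reading. [cite: BalabanImbrieJaffe1988, (5.12.8) p.303] -/
def readEntry {α : Type} (Λ : ι → Finset (PBond P (k+1))) (Qu : GaugeField P k U1 → GaugeField P (k+1) U1) (F : Entry P k ι α) (t : ι)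
    (q : Cfg P k) (v' : GaugeField P (k+1) U1) (ψ : HiggsField P (k+1)) : α :=
  F t q.2.1 (uCut Qu (Λ t) q.1) (vCut Qu (Λ t) q.1 v') q.2.2 ψ

/-- **THE EXTERIOR BRACKET OF (5.12.8), LINES 2–7, AS TYPED SLOTS** (one field per printed factor; the constructions are the rows C2.Eq5.2.x–5.12.7
of the skeleton and are NOT repeated here). [cite: BalabanImbrieJaffe1988, (5.12.8) p.303] -/
structure Exterior5128 (P : Params) (k : ℕ) (ι : Type*) where
  /-- `ζ_{Λ^{(k)c}_0} χ_{Λ^{(k)}_0∩Λ^{(k)c}_9} ζ′_{Λ̃^{(k)c}} χ_{k+1,Λ^{(k)′}_0}` — the characteristic functions after the p. 300 expansion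
  `Π χ = Σ Π(−χ^c)` (`ζ′`: r16's `zetaPrime300`; (5.2.7), (5.2.2), p. 297, p. 300). -/
  chars : Entry P k ι ℝ
  /-- `Π_ω g_k(X_ω)` — the large-field functionals of (4.1). -/
  holes : Entry P k ι ℂ
  /-- `Π_{σ∉σ̃_1} F′_{(k),loc}(X_σ)` — the observable factors kept outside (p. 300: `F′_{k,loc} = F̃_{k,loc} + F″_{k,loc}`, Sect. 5.10). -/
  obsOut : Entry P k ι ℂ
  /-- `Π_{(j,x_j,X)∈S_4} (e^{−W^{(k)}_{4,j}(x_j,X)} − 1)` — the Mayer factors of (5.11.2). -/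
  mayer4 : Entry P k ι ℝ
  /-- `Π_{j=0}^{k} [Z^{(j)}_{Λ^{(j)c*c}_{10}} Z^{(j)}_{Λ^{(j)}_{10}}(u_{k+1})]` — the Gaussian normalization factors ((4.9), (5.7.13), (5.12.1), (5.12.3)). -/
  zf : Entry P k ι ℝ
  /-- `⟨Λ^{(k)′**}_5 f, σ^L_{k+1,loc}Λ^{(k)′**}_5 f⟩` ((5.5.10)–(5.5.12)). -/
  quadF : Entry P k ι ℝ
  /-- `⟨Λ^{(k)′}_8ψ, Δ^L_{k+1,loc}(u_{k+1})Λ^{(k)′}_8ψ⟩` ((5.8.3)). -/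
  quadPsi : Entry P k ι ℝ
  /-- `𝒬_1, …, 𝒬_8` ((5.3.5), (5.5.9), (5.5.12), (5.8.2), (5.8.3); `𝒬_7`, `𝒬_8` the quadratic forms of (5.12.1)/(5.12.6), p. 302). -/
  calQ : Fin 8 → Entry P k ι ℝ
  /-- `ℰ_k` (the constant of (4.1)/(3.10)). -/
  calE : Entry P k ι ℝ
  /-- `E^{(k)}` ((5.1.2)). -/
  Ek : Entry P k ι ℝ
  /-- `𝒫_{k,loc}(Λ^{k+1}_8, Λ^{(k)c}_8, ũ_{k+1})` — the interaction terms without localizations in `Λ^{(k)}_8` ((5.6.13), Sect. 5.10). -/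
  Pkloc : Entry P k ι ℝ
  /-- `R^{(k)}(Λ^{(k)c}_8, u_{k+1}, θ_kH_{k,loc}A^{(k)})` ((5.6.14), Sect. 5.10). -/
  Rk : Entry P k ι ℝ
  /-- `Q^{(k)}(Λ^{(k)c}_8, u_{k+1}, θ_kH_{k,loc}A^{(k)})` ((5.7.13), Sect. 5.10). -/
  Qk : Entry P k ι ℝ

/-- **THE INTERIOR BRACKET OF (5.12.8), LINES 7–8, AS TYPED SLOTS**. [cite: BalabanImbrieJaffe1988, (5.12.8) p.303] -/
structure Interior5128 (P : Params) (k : ℕ) (ι : Type*) where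
  /-- `χ′_{Λ^{(k)}_7}` — the characteristic functions of p. 297 kept inside the conditional integral. -/
  chi7 : Entry P k ι ℝ
  /-- `Π_{σ_1∈σ̃_1} F^{m̄}_{k,loc}(X_{σ_1})` — the low-order observable factors (Sect. 5.10). -/
  obsIn : Entry P k ι ℂ
  /-- `V^{(k)}(Λ^{(k)}_8, u_{k+1}, A^{(k)}, φ^{(k)})` — the fluctuation-field interaction of Sect. 5.10. -/
  Vk : Entry P k ι ℝ
  /-- `Σ_X W^{(k)}_5(X)` — the small non-local terms of p. 302. -/
  W5 : Entry P k ι ℝ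

variable (DX : Exterior5128 P k ι) (DI : Interior5128 P k ι)

/-- **THE EXPONENT OF THE EXTERIOR BRACKET, lines 4–7** — *"exp[ −½⟨Λ₅′**f, σ^L_{k+1,loc}Λ₅′**f⟩ − ½⟨Λ₈′ψ, Δ^L_{k+1,loc}(u_{k+1})Λ₈′ψ⟩ − Σ_{i=1}^{8}𝒬_i − ℰ_k −
E^{(k)} − 𝒫_{k,loc}(Λ₈^{k+1}, Λ₈^{(k)c}, ũ_{k+1}) − R^{(k)}(…) − Q^{(k)}(…) ]"* (transcribed, printed order, printed `½`'s). [cite: BalabanImbrieJaffe1988, (5.12.8) p.303] -/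
def exteriorExponent5128 : Entry P k ι ℝ := fun t prev u v φ ψ =>
  -(DX.quadF t prev u v φ ψ / 2 + DX.quadPsi t prev u v φ ψ / 2 + ∑ i : Fin 8, DX.calQ i t prev u v φ ψ
    + DX.calE t prev u v φ ψ + DX.Ek t prev u v φ ψ + DX.Pkloc t prev u v φ ψ + DX.Rk t prev u v φ ψ + DX.Qk t prev u v φ ψ)

/-- **THE EXTERIOR BRACKET OF (5.12.8), lines 2–7, transcribed**: `ζχζ′χ_{k+1} · Πg_k · Π_{σ∉σ̃₁}F′ · Π_{S₄}(e^{−W₄}−1) · Π[ZZ(u_{k+1})] · exp[…]`.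
[cite: BalabanImbrieJaffe1988, (5.12.8) p.303] -/
def exteriorBracket5128 : Entry P k ι ℂ := fun t prev u v φ ψ =>
  (DX.chars t prev u v φ ψ : ℂ) * DX.holes t prev u v φ ψ * DX.obsOut t prev u v φ ψ * (DX.mayer4 t prev u v φ ψ : ℂ) *
    (DX.zf t prev u v φ ψ : ℂ) * (Real.exp (exteriorExponent5128 DX t prev u v φ ψ) : ℂ)

/-- **THE INTERIOR BRACKET OF (5.12.8), lines 7–8, transcribed**: `χ′_{Λ₇} · Π_{σ₁∈σ̃₁}F^{m̄}_{k,loc}(X_{σ₁}) · exp[−V^{(k)} − Σ_X W₅^{(k)}(X)]`.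
[cite: BalabanImbrieJaffe1988, (5.12.8) p.303] -/
def interiorBracket5128 : Entry P k ι ℂ := fun t prev u v φ ψ =>
  (DI.chi7 t prev u v φ ψ : ℂ) * DI.obsIn t prev u v φ ψ * (Real.exp (-(DI.Vk t prev u v φ ψ + DI.W5 t prev u v φ ψ)) : ℂ)

/-- **(5.12.8) WITH THE TRANSCRIBED BRACKETS**: the display for given exterior measures `ext_t`, interior laws `μ_t` and a normalization factor `𝒩_t`
(the closed-form Gaussian factor `Π[ZZ]·e^{½⟨…⟩}` of (5.12.1)/(5.12.3) is part of the printed exterior bracket — slot `zf` and `𝒬₇`, `𝒬₈`; at measure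
level the factor produced by the conditioning is `𝒩_t`, p02's `BIJ88ExteriorForms5121`/`BIJ88Conditioning512.calN_eq` evaluate it in coordinates):
`IsDC terms Λ Qu ext ((readEntry exteriorBracket5128)·𝒩) cond (readEntry interiorBracket5128) ρ`. [cite: BalabanImbrieJaffe1988, (5.12.8) p.303] -/
def IsDC5128 (terms : Finset ι) (Λ : ι → Finset (PBond P (k+1))) (Qu : GaugeField P k U1 → GaugeField P (k+1) U1)
    (ext : ι → Measure (Cfg P k)) (N : ι → Cfg P k → GaugeField P (k+1) U1 → HiggsField P (k+1) → ℝ)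
    (cond : ι → Cfg P k → GaugeField P (k+1) U1 → HiggsField P (k+1) → Measure (Cfg P k))
    (ρL : GaugeField P (k+1) U1 → HiggsField P (k+1) → ℂ) : Prop :=
  IsDC terms Λ Qu ext (fun t q v' ψ => readEntry Λ Qu (exteriorBracket5128 DX) t q v' ψ * (N t q v' ψ : ℂ)) cond
    (readEntry Λ Qu (interiorBracket5128 DI)) ρL

/-- kernel: the transcribed display is the general one with the transcribed brackets (definitional). [cite: BalabanImbrieJaffe1988, (5.12.8) p.303] -/
theorem isDC5128_iff (terms : Finset ι) (Λ : ι → Finset (PBond P (k+1))) (Qu : GaugeField P k U1 → GaugeField P (k+1) U1)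
    (ext : ι → Measure (Cfg P k)) (N : ι → Cfg P k → GaugeField P (k+1) U1 → HiggsField P (k+1) → ℝ)
    (cond : ι → Cfg P k → GaugeField P (k+1) U1 → HiggsField P (k+1) → Measure (Cfg P k))
    (ρL : GaugeField P (k+1) U1 → HiggsField P (k+1) → ℂ) :
    IsDC5128 DX DI terms Λ Qu ext N cond ρL ↔
      IsDC terms Λ Qu ext (fun t q v' ψ => readEntry Λ Qu (exteriorBracket5128 DX) t q v' ψ * (N t q v' ψ : ℂ)) cond
        (readEntry Λ Qu (interiorBracket5128 DI)) ρL :=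
  Iff.rfl

end Printed

/-! ## §3 Re-indexing the translated display under the expansions of Sect. 5.11 -/

section Expand

variable {α β γ δ ε : Type*} [MeasurableSpace α] [MeasurableSpace β] [MeasurableSpace γ] [MeasurableSpace δ] [MeasurableSpace ε]
variable {μa : Measure α} {μb : Measure β} {μc : Measure γ} {μd : Measure δ} {μe : Measure ε}
variable [SFinite μa] [SFinite μb] [SFinite μc] [SFinite μd] [SFinite μe]
variable {E : Type*} [NormedAddCommGroup E] [NormedSpace ℝ E]

/-- kernel: five-fold Fubini in the nesting order, `∫_{a⊗(b⊗(c⊗(d⊗e)))} K = ∫a∫b∫c∫d∫e K`. [folklore] -/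
private theorem integral_prod₅ {K : α × (β × (γ × (δ × ε))) → E} (hK : Integrable K (μa.prod (μb.prod (μc.prod (μd.prod μe))))) :
    ∫ q, K q ∂μa.prod (μb.prod (μc.prod (μd.prod μe))) = ∫ a, ∫ b, ∫ c, ∫ d, ∫ e, K (a, (b, (c, (d, e)))) ∂μe ∂μd ∂μc ∂μb ∂μa := by
  rw [integral_prod _ hK]
  refine integral_congr_ae ?_
  filter_upwards [hK.prod_right_ae] with a ha
  rw [integral_prod _ ha]
  refine integral_congr_ae ?_
  filter_upwards [ha.prod_right_ae] with b hb
  rw [integral_prod _ hb]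
  refine integral_congr_ae ?_
  filter_upwards [hb.prod_right_ae] with c hc
  rw [integral_prod _ hc]

/-- kernel: four-fold Fubini in the nesting order. [folklore] -/
private theorem integral_prod₄ {K : α × (β × (γ × δ)) → E} (hK : Integrable K (μa.prod (μb.prod (μc.prod μd)))) :
    ∫ q, K q ∂μa.prod (μb.prod (μc.prod μd)) = ∫ a, ∫ b, ∫ c, ∫ d, K (a, (b, (c, d))) ∂μd ∂μc ∂μb ∂μa := by
  rw [integral_prod _ hK]
  refine integral_congr_ae ?_
  filter_upwards [hK.prod_right_ae] with a ha
  rw [integral_prod _ ha]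
  refine integral_congr_ae ?_
  filter_upwards [ha.prod_right_ae] with b hb
  rw [integral_prod _ hb]

/-- The measure of the four INNER iterated integrals `ν, Π𝒟u^{(j)}, dψ, 𝒟φ` of one term of the translated display. [cite: BalabanImbrieJaffe1988, (5.9.6) p.297] -/
def innerMeasure (ν : Measure (UCfg P k)) : Measure (UCfg P k × (PCfg P k × (HiggsField P (k+1) × HiggsField P k))) :=
  ν.prod ((prevPi P k).prod ((volume : Measure (HiggsField P (k+1))).prod (volume : Measure (HiggsField P k))))

/-- kernel (plumbing): the inner measure is s-finite. [cite: BalabanImbrieJaffe1988, (5.9.6) p.297] -/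
instance sFinite_innerMeasure (ν : Measure (UCfg P k)) [SFinite ν] : SFinite (innerMeasure (P := P) (k := k) ν) := by
  unfold innerMeasure; infer_instance

/-- **Moving `ψ` outermost**: `(u, ({u^{(j)}}, (ψ, φ))) ↦ (ψ, (u, ({u^{(j)}}, φ)))` — the exterior variables of the conditioning include `ψ`, so the
`dψ`-integral of (5.9.6) is taken outside the configuration integral before conditioning (a measurable equivalence built from Mathlib's associator and
swap). [cite: BalabanImbrieJaffe1988, (5.12.8) p.303] -/
def psiOut : UCfg P k × (PCfg P k × (HiggsField P (k+1) × HiggsField P k)) ≃ᵐ HiggsField P (k+1) × Cfg P k :=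
  (((MeasurableEquiv.refl (UCfg P k)).prodCongr
      (((MeasurableEquiv.refl (PCfg P k)).prodCongr
        (MeasurableEquiv.prodComm : HiggsField P (k+1) × HiggsField P k ≃ᵐ HiggsField P k × HiggsField P (k+1))).trans
        (MeasurableEquiv.prodAssoc : (PCfg P k × HiggsField P k) × HiggsField P (k+1) ≃ᵐ _).symm)).trans
    (MeasurableEquiv.prodAssoc : (UCfg P k × (PCfg P k × HiggsField P k)) × HiggsField P (k+1) ≃ᵐ _).symm).trans
    MeasurableEquiv.prodComm

/-- kernel: the value of `psiOut`. [cite: BalabanImbrieJaffe1988, (5.12.8) p.303] -/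
theorem psiOut_apply (r : UCfg P k × (PCfg P k × (HiggsField P (k+1) × HiggsField P k))) :
    psiOut r = (r.2.2.1, (r.1, (r.2.1, r.2.2.2))) := rfl

/-- **`psiOut` preserves the measures**: `ν ⊗ Π𝒟u^{(j)} ⊗ dψ ⊗ 𝒟φ ≅ dψ ⊗ (ν ⊗ Π𝒟u^{(j)} ⊗ 𝒟φ)`. [cite: BalabanImbrieJaffe1988, (5.12.8) p.303] -/
theorem measurePreserving_psiOut (ν : Measure (UCfg P k)) [SFinite ν] :
    MeasurePreserving (psiOut (P := P) (k := k)) (innerMeasure ν) ((volume : Measure (HiggsField P (k+1))).prod (cfgMeasure ν)) := by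
  have h1 : MeasurePreserving (Prod.map (id : PCfg P k → PCfg P k) (Prod.swap : HiggsField P (k+1) × HiggsField P k → _))
      ((prevPi P k).prod ((volume : Measure (HiggsField P (k+1))).prod (volume : Measure (HiggsField P k))))
      ((prevPi P k).prod ((volume : Measure (HiggsField P k)).prod (volume : Measure (HiggsField P (k+1))))) :=
    (MeasurePreserving.id _).prod Measure.measurePreserving_swap
  have h2 := (measurePreserving_prodAssoc (prevPi P k) (volume : Measure (HiggsField P k)) (volume : Measure (HiggsField P (k+1)))).symm
    MeasurableEquiv.prodAssoc
  have h3 : MeasurePreserving (Prod.map (id : UCfg P k → UCfg P k)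
      ((MeasurableEquiv.prodAssoc : (PCfg P k × HiggsField P k) × HiggsField P (k+1) ≃ᵐ _).symm ∘ Prod.map id Prod.swap))
      (innerMeasure ν) (ν.prod (((prevPi P k).prod (volume : Measure (HiggsField P k))).prod (volume : Measure (HiggsField P (k+1))))) := by
    unfold innerMeasure
    exact (MeasurePreserving.id ν).prod (h2.comp h1)
  have h4 := (measurePreserving_prodAssoc ν ((prevPi P k).prod (volume : Measure (HiggsField P k))) (volume : Measure (HiggsField P (k+1)))).symm
    MeasurableEquiv.prodAssoc
  have h5 : MeasurePreserving (Prod.swap : (UCfg P k × (PCfg P k × HiggsField P k)) × HiggsField P (k+1) → _)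
      ((ν.prod ((prevPi P k).prod (volume : Measure (HiggsField P k)))).prod (volume : Measure (HiggsField P (k+1))))
      ((volume : Measure (HiggsField P (k+1))).prod (cfgMeasure ν)) := by
    unfold cfgMeasure; exact Measure.measurePreserving_swap
  have h := h5.comp (h4.comp h3)
  convert h using 1
  funext r
  rfl

/-- **The four inner integrals with `ψ` moved outside**: `∫ν∫Π𝒟u^{(j)}∫dψ∫𝒟φ K = ∫dψ ∫_{Cfg} K d(cfgMeasure ν)` for an integrable `K`.
[cite: BalabanImbrieJaffe1988, (5.12.8) p.303] -/
theorem iter₄_eq_psi_cfg (ν : Measure (UCfg P k)) [SFinite ν] {K : HiggsField P (k+1) × Cfg P k → E}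
    (hK : Integrable K ((volume : Measure (HiggsField P (k+1))).prod (cfgMeasure ν))) :
    ∫ U, ∫ prev, ∫ ψ, ∫ φ, K (ψ, (U, (prev, φ))) ∂volume ∂volume ∂prevPi P k ∂ν = ∫ ψ, ∫ q, K (ψ, q) ∂cfgMeasure ν ∂volume := by
  have hmp := measurePreserving_psiOut (P := P) (k := k) ν
  have hK' : Integrable (K ∘ psiOut) (innerMeasure ν) := (hmp.integrable_comp hK.aestronglyMeasurable).mpr hK
  have e1 : ∫ U, ∫ prev, ∫ ψ, ∫ φ, K (ψ, (U, (prev, φ))) ∂volume ∂volume ∂prevPi P k ∂ν = ∫ r, (K ∘ psiOut) r ∂innerMeasure ν := by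
    unfold innerMeasure at hK' ⊢
    rw [integral_prod₄ hK']
    rfl
  rw [e1]
  have e2 : ∫ r, (K ∘ psiOut) r ∂innerMeasure ν = ∫ z, K z ∂(volume : Measure (HiggsField P (k+1))).prod (cfgMeasure ν) :=
    hmp.integral_comp' (g := K)
  rw [e2, integral_prod _ hK]

omit [NormedSpace ℝ E] in
/-- **A tested integrand that is integrable against `dψ ⊗ cfgMeasure` is integrable against `cfgMeasure` for a.e. `ψ`.** [cite: BalabanImbrieJaffe1988, (5.12.8) p.303] -/
theorem ae_integrable_section (ν : Measure (UCfg P k)) [SFinite ν] {K : HiggsField P (k+1) × Cfg P k → E}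
    (hK : Integrable K ((volume : Measure (HiggsField P (k+1))).prod (cfgMeasure ν))) :
    ∀ᵐ ψ ∂(volume : Measure (HiggsField P (k+1))), Integrable (fun q => K (ψ, q)) (cfgMeasure ν) :=
  hK.prod_right_ae

variable {ι ι' : Type*} {terms : Finset ι} {Λ : ι → Finset (PBond P (k+1))} {Qu : GaugeField P k U1 → GaugeField P (k+1) U1}
variable {ν : Measure (UCfg P k)}
variable {J : ι → Prev P k → GaugeField P k U1 → GaugeField P (k+1) U1 → HiggsField P k → HiggsField P (k+1) → ℂ}
variable {ρL : GaugeField P (k+1) U1 → HiggsField P (k+1) → ℂ}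

/-- The measure of the five iterated integrals of one term of the translated display, in their order `dv′, ν, Π𝒟u^{(j)}, dψ, 𝒟φ`.
[cite: BalabanImbrieJaffe1988, (5.9.6) p.297] -/
def termMeasure (ν : Measure (UCfg P k)) :
    Measure (GaugeField P (k+1) U1 × (UCfg P k × (PCfg P k × (HiggsField P (k+1) × HiggsField P k)))) :=
  (fieldMeasure P (k+1) U1).prod (innerMeasure ν)

/-- kernel: the term measure is `dv′ ⊗ (inner measure)` (definitional). [cite: BalabanImbrieJaffe1988, (5.9.6) p.297] -/
theorem termMeasure_eq (ν : Measure (UCfg P k)) : termMeasure ν = (fieldMeasure P (k+1) U1).prod (innerMeasure ν) := rfl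

/-- kernel (plumbing): the term measure is s-finite. [cite: BalabanImbrieJaffe1988, (5.9.6) p.297] -/
instance sFinite_termMeasure (ν : Measure (UCfg P k)) [SFinite ν] : SFinite (termMeasure (P := P) (k := k) ν) := by
  unfold termMeasure; infer_instance

/-- The integrand of one term of the translated display read on the product space: `r = (v′, u, {u^{(j)}}, ψ, φ) ↦ J_t({u^{(j)}}, u′_Λ(u), v_Λ(u,v′), φ, ψ)`.
[cite: BalabanImbrieJaffe1988, (5.9.6) p.297] -/
def termIntegrand (Λ : ι → Finset (PBond P (k+1))) (Qu : GaugeField P k U1 → GaugeField P (k+1) U1)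
    (J : ι → Prev P k → GaugeField P k U1 → GaugeField P (k+1) U1 → HiggsField P k → HiggsField P (k+1) → ℂ) (t : ι)
    (r : GaugeField P (k+1) U1 × (UCfg P k × (PCfg P k × (HiggsField P (k+1) × HiggsField P k)))) : ℂ :=
  J t r.2.2.1 (uCut Qu (Λ t) r.2.1) (vCut Qu (Λ t) r.2.1 r.1) r.2.2.2.2 r.2.2.2.1

/-- kernel: a term's five iterated integrals of an integrable tested integrand are its integral against the term measure.
[cite: BalabanImbrieJaffe1988, (5.9.6) p.297] -/
theorem iter₅_eq_integral_termMeasure [SFinite ν] {t : ι} {g : GaugeField P (k+1) U1 × HiggsField P (k+1) → ℂ}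
    (hK : Integrable (fun r => termIntegrand Λ Qu J t r * g (vCut Qu (Λ t) r.2.1 r.1, r.2.2.2.1)) (termMeasure ν)) :
    ∫ v', ∫ U, ∫ prev, ∫ ψ, ∫ φ,
        J t prev (uCut Qu (Λ t) U) (vCut Qu (Λ t) U v') φ ψ * g (vCut Qu (Λ t) U v', ψ)
        ∂volume ∂volume ∂prevMeasure P k ∂ν ∂fieldMeasure P (k+1) U1 =
      ∫ r, termIntegrand Λ Qu J t r * g (vCut Qu (Λ t) r.2.1 r.1, r.2.2.2.1) ∂termMeasure ν := by
  unfold termMeasure innerMeasure at hK ⊢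
  rw [integral_prod₅ hK]
  rfl

/-- **RE-INDEXING THE TRANSLATED DISPLAY UNDER A POINTWISE FINITE-SUM EXPANSION OF THE BRACKETS** — Sect. 5.11 p. 299 *"The Mayer expansion is the
usual identity exp[−Σ_X W^{(k)}_4(X)] = Σ_{S_4} Π_{X∈S_4}(e^{−W^{(k)}_4(X)} − 1) (5.11.2) … Then S_4 is summed over subsets of S_4"*, p. 300 *"We also
expand out the observable … with σ̃_1 summed over subsets"*, *"The characteristic function expansion can now be written as … Σ_{{S_x,S_y,S_b,S_p}}"*:
if every bracket `J_t` of the display over `terms` is pointwise the finite sum `Σ_{s : π s = t} J′_s` of new brackets indexed by `terms′` (parent map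
`π : terms′ → terms`), each jointly integrable, then the same density satisfies the display over `terms′` with the brackets `J′_s` and the parent's
cut-off.  (The pointwise identities themselves — (5.11.2) is r16's `BIJ88Sect5Statements.eq5112`, the p. 300 expansions `obs_expand300`/
`chi_expand300` — are the hypothesis `hJ`.) [cite: BalabanImbrieJaffe1988, (5.11.2) p.299] -/
theorem isDT_expand [SFinite ν] [DecidableEq ι] (h : IsDT ν terms Λ Qu J ρL) (terms' : Finset ι') (π : ι' → ι) (hπ : ∀ s ∈ terms', π s ∈ terms)
    (J' : ι' → Prev P k → GaugeField P k U1 → GaugeField P (k+1) U1 → HiggsField P k → HiggsField P (k+1) → ℂ)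
    (hJ : ∀ t ∈ terms, ∀ prev u v φ ψ, J t prev u v φ ψ = ∑ s ∈ terms'.filter (fun s => π s = t), J' s prev u v φ ψ)
    (hQu : Measurable Qu)
    (hJ'i : ∀ s ∈ terms', Integrable (termIntegrand (Λ ∘ π) Qu J' s) (termMeasure ν)) :
    IsDT ν terms' (Λ ∘ π) Qu J' ρL := by
  intro g hg hb
  obtain ⟨C, hC⟩ := hb
  rw [h g hg ⟨C, hC⟩]
  -- the measurability of the tested factor
  have hgm : ∀ t : ι, Measurable fun r : GaugeField P (k+1) U1 × (UCfg P k × (PCfg P k × (HiggsField P (k+1) × HiggsField P k))) =>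
      g (vCut Qu (Λ t) r.2.1 r.1, r.2.2.2.1) := by
    intro t
    refine hg.comp (Measurable.prodMk ?_ (measurable_fst.comp (measurable_snd.comp measurable_snd.snd)))
    refine measurable_pi_iff.mpr fun c => ?_
    by_cases hc : c ∈ Λ t
    · simp only [BIJ88Eq596Display.vCut_apply, if_pos hc]; exact (measurable_pi_apply c).comp measurable_fst
    · simp only [BIJ88Eq596Display.vCut_apply, if_neg hc]
      exact (measurable_pi_apply c).comp (hQu.comp measurable_snd.fst)
  -- each new term, tested, is integrable against the term measure
  have hI : ∀ s ∈ terms', Integrable (fun r => termIntegrand (Λ ∘ π) Qu J' s r * g (vCut Qu (Λ (π s)) r.2.1 r.1, r.2.2.2.1)) (termMeasure ν) :=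
    fun s hs => (hJ'i s hs).mul_bdd (hgm (π s)).aestronglyMeasurable (Filter.Eventually.of_forall fun r => hC _)
  -- regroup the new terms by parent
  rw [← Finset.sum_fiberwise_of_maps_to (g := π) (fun s hs => hπ s hs)]
  refine Finset.sum_congr rfl fun t ht => ?_
  -- the parent's term: its bracket is the sum of the children's brackets
  have e1 : ∫ v', ∫ U, ∫ prev, ∫ ψ, ∫ φ,
        J t prev (uCut Qu (Λ t) U) (vCut Qu (Λ t) U v') φ ψ * g (vCut Qu (Λ t) U v', ψ)
        ∂volume ∂volume ∂prevMeasure P k ∂ν ∂fieldMeasure P (k+1) U1 =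
      ∫ r, (∑ s ∈ terms'.filter (fun s => π s = t), termIntegrand (Λ ∘ π) Qu J' s r * g (vCut Qu (Λ (π s)) r.2.1 r.1, r.2.2.2.1))
        ∂termMeasure ν := by
    have hsum : Integrable (fun r => ∑ s ∈ terms'.filter (fun s => π s = t),
        termIntegrand (Λ ∘ π) Qu J' s r * g (vCut Qu (Λ (π s)) r.2.1 r.1, r.2.2.2.1)) (termMeasure ν) :=
      integrable_finsetSum _ fun s hs => hI s (Finset.mem_filter.mp hs).1
    have hK : Integrable (fun r => termIntegrand Λ Qu J t r * g (vCut Qu (Λ t) r.2.1 r.1, r.2.2.2.1)) (termMeasure ν) := by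
      refine hsum.congr (Filter.Eventually.of_forall fun r => ?_)
      simp only [termIntegrand, Function.comp_apply]
      rw [hJ t ht, Finset.sum_mul]
      refine Finset.sum_congr rfl fun s hs => ?_
      rw [(Finset.mem_filter.mp hs).2]
    rw [iter₅_eq_integral_termMeasure hK]
    refine integral_congr_ae (Filter.Eventually.of_forall fun r => ?_)
    simp only [termIntegrand, Function.comp_apply]
    rw [hJ t ht, Finset.sum_mul]
    refine Finset.sum_congr rfl fun s hs => ?_
    rw [(Finset.mem_filter.mp hs).2]
  refine e1.trans ?_
  rw [integral_finsetSum _ fun s hs => hI s (Finset.mem_filter.mp hs).1]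
  refine Finset.sum_congr rfl fun s hs => ?_
  exact (iter₅_eq_integral_termMeasure (hI s (Finset.mem_filter.mp hs).1)).symm

end Expand

end

end Literature.MathematicalPhysics.QuantumFieldTheory.BalabanImbrieJaffe1984to88.BIJ88Eq5128Display
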